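import Literature.MathematicalPhysics.QuantumFieldTheory.Balaban1983to89.HiggsLattice
import Literature.MathematicalPhysics.QuantumFieldTheory.Balaban1983to89.B1LowerBound

/-!
# `Balaban1983to89.B1Sect1Statements` — T. Bałaban, *(Higgs)₂,₃ quantum fields in a finite volume. I. A lower
# bound*, Commun. Math. Phys. **85** (1982) 603–626 [Balaban1982Higgs1]: Sect. 1 — the renormalized partition
# function (1.10)–(1.13) CONCRETELY (counterterms `E₀` (1.12), `E₁` (1.13), `δm²`) over the carrier `HiggsLattice`,
# and the THEOREM (1.14) p. 606 INSTANTIATED at this concrete cutoff family (statement of record: `B1LowerBound`);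
# v1.1: (1.13) REPAIRED to the one-sided reading (`e1R`, `zRenR`, `cutoffFamilyR`, `Thm114R`) + counterterm-generic forms

statement-level skeleton of published theorems with citation tags; proofs where landed; nothing here is a claim about
the Yang–Mills mass gap

PDF held: `paper:balaban1982-cmp85-higgs23-i` (journal page = PDF page + 602).  Read from the ×2 page renders
`run/shared/lean/pub/pub-balaban/b2b-balaban-ref1/pages/1982-cmp85-higgs23-I/1982-cmp85-higgs23-I-p003…p005-x2.png`
(pp. 605–607), never from the OCR layer.

CITATION HEADER (lean-in-tree rule).  This module belongs to the lit-balaban TYPED SKELETON (HOME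
`run/shared/lean/pub/lit-balaban/`, SKELETON.md rows `B1.Thm@606`, `B1.Eq1.12`, `B1.Eq1.13`, `B1.Eq1.9-1.10`; unit
`lit-balaban-r01`, B1 fold owner).  RELATION TO THE TREE (read first; nothing restated): `…Balaban1983to89.HiggsLattice`
(lit-balaban typer) is the CONCRETE carrier of Sect. 1 — tori `Params`/`Site` (1.2), `ChargeData` (`U(A) = exp(qεeA)`,
p. 605), `Couplings`, the action (1.11) `action`, the partition function (1.10) `partitionFn`, the free constant (1.12)
`freeNormalization`, the volume (1.21) `Params.vol`; `…Balaban1983to89.B1LowerBound` (unit lit-balaban-r14) types the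
THEOREM (1.14) and its halves over an ABSTRACT carrier `B1LowerBound.CutoffFamily I` (fields `eps`, `vol` ↤ |T_ε|,
`Z` ↤ Z^ε — *"counterterms δm², E = E₀ + E₁ of (1.12)–(1.13) included"* by fiat) and is the decl of record for row
`B1.Thm@606`.  WHAT THIS MODULE ADDS (and only this): (a) the model data held fixed in the paper (`ModelData`) and the
partition function as a function of the couplings `(e', λ')` and of the vacuum constant `E` (`ModelData.zOf`); (b) the
counterterm `E₁` (1.13) as the printed Taylor sum of iterated derivatives of `log Z` at `e = λ = 0` (`ModelData.e1`;
`ModelData.e0` = (1.12) = `HiggsLattice.freeNormalization`); (c) the renormalized partition function `Z^ε` of the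
Theorem with `m₀² = m² + δm²` and `E = E₀ + E₁` (`ModelData.zRen`), the volume `|T_ε|` (`volT`); (d) the CONCRETE
CUTOFF FAMILY `ModelData.cutoffFamily : B1LowerBound.CutoffFamily {P // admissible}` (one instance = one admissible
lattice `P : Params`), and the Theorem instantiated there: `Thm114 D := (standing hypotheses) →
B1LowerBound.ThmPrinted D.cutoffFamily` — NOT a second statement of (1.14) but r14's statement at the concrete
family, with the kernel-checked unfolding `thmPrinted_cutoffFamily_iff` showing it reads, verbatim, *"∃ E₋, E₊
(chosen before ε, T_ε) with exp(−E₋|T_ε|) ≤ Z^ε ≤ exp(E₊|T_ε|) on every admissible lattice"*.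
HONEST SCOPE / reader's notes (ref-1 F2, F6, F7): (i) the mass counterterm `δm²` is NOT written down in the paper
(p. 605, verbatim below) — it is carried as an explicit argument `δmsq : ℝ → ℝ → ℝ → ℝ` (a function of `(ε, e', λ')`;
its dependence on `m², μ₀², q` is through the fixed model data) of `ModelData`, and the Theorem AS PRINTED is the
instance of `Thm114` at the paper's (perturbatively determined, cf. [Balaban1983Higgs3] (1.23)–(1.29)) `δm²`;
(ii) *"δm² is a N × N-matrix depending on q². For simplicity of notations we will treat it as a number"* — typed as
a number, as the print does; (iii) `E₋, E₊` "independent of ε, T_ε": they are chosen after the model data (`d, N,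
q, e, λ, m², μ₀², n̄, L, M` and `δm²`) and before the lattice `P : Params` (spacing `ε`, torus `T_ε` with
`ε⁻¹L_μ = L^K M L'_μ`), exactly as printed; (iv) the assumptions *"μ₀² > 0 and λ > 0"*, *"m² > 0"*, *"n̄ ≥ 6"*,
*"d = 2, 3"* are the hypotheses of `Thm114`; (v) in (1.13) the mixed partial `∂^{α+β}/∂e^α∂λ^β` at `e = λ = 0` is
typed as the iterated one-variable derivatives `iteratedDeriv α (e' ↦ iteratedDeriv β (λ' ↦ log Z) 0) 0` (equal to
the printed mixed partial for the smooth function `log Z`; smoothness is not asserted here) — SEE THE v1.1 REPAIR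
BELOW: the two-sided `λ'`-derivative is the WRONG reading; (vi) the extension (1.15) is r14's
`B1LowerBound.Ext115Printed` (abstract sources) and is not instantiated here (v1.1: it is, by typer g23's
`B1Eq115GeneratingFunctional`).  Nothing of the paper is asserted: `Thm114` is consumed only as a hypothesis.

v1.1 (unit `lit-balaban-r01` gen 12) — SEMANTIC REPAIR OF (1.13), append-only (LOCATED DEFECT found and kernel-checked
by typer g24, `B1Eq113OneSidedDerivatives` p330976: for `N ≥ 1` and `λ' < 0` the integrand `exp(−S^ε)` of (1.10) is
not integrable — the negative quartic wins —, so with Lean's total conventions (`∫` of a non-integrable function `= 0`,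
`Real.log 0 = 0`, `deriv` of a non-differentiable function `= 0`) the function `λ' ↦ logZ P e' λ'` VANISHES on
`(−∞, 0)` and every `β ≥ 1` term of `ModelData.e1` is `0`: the v1.0 decl keeps only the pure-`e` counterterms, which is
NOT the printed `E₁`).  WHAT THE PRINT DENOTES (*"given again by a perturbation expansion"*, p. 606) is the Taylor
coefficient of the perturbation series, i.e. the RIGHT derivative in `λ` at `λ = 0⁺` ((1.13) never looks at `λ < 0`;
*"we will assume that μ₀² > 0 and λ > 0"*, p. 605).  REPAIRED DECLS OF RECORD (new names; the v1.0 decls are kept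
verbatim for their importers and flagged): **`ModelData.e1R`** — (1.13) with the `λ'`-derivatives taken WITHIN
`[0, ∞)` at `0` (`iteratedDerivWithin β (λ' ↦ logZ P e' λ') (Set.Ici 0) 0`), the `e'`-derivatives two-sided as before;
**`ModelData.zRenR`**, **`ModelData.cutoffFamilyR`**, **`Thm114R`**, **`LowerBound114R`** — the renormalized partition
function, the concrete cutoff family and the instantiated Theorem / lower bound built on `e1R`; and the
counterterm-GENERIC forms `ModelData.zRenWith P E₁` / `cutoffFamilyWith E₁` / `Thm114With D E₁` / `LowerBound114With D E₁`
(an arbitrary vacuum counterterm `E₁ : Params → ℝ` in place of (1.13)), of which the v1.0 and the v1.1 families are the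
instances at `e1` and `e1R` (`zRen_eq_zRenWith`, `cutoffFamily_eq_cutoffFamilyWith`, `thm114_iff_thm114With`, … all
`rfl`), so that downstream assemblies (r14's `B1LowerBound114Model` / `B1Ineq368QuadForms` / `B1Eq369Model`, typer's
`B1Eq115GeneratingFunctional`) can be re-threaded ONCE over `E₁` and specialised.  HONEST SCOPE of the repair:
(v′) `e1R` differentiates `λ' ↦ log Z` from the right at `0` and `e'` two-sidedly at `0`, inner variable `λ'`, outer
`e'` (a convention; equal to the printed mixed partial for a function jointly smooth on `ℝ × [0, ∞)` near `(0,0)`);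
joint smoothness — in particular the `(e', λ')`-regularity of the data `δm²`, cf. [Balaban1983Higgs3] (1.23) — is NOT
recorded in `ModelData` and not asserted; at `λ' = 0` the integral `Z(e', 0; 0)` is finite when
`m² + δm²(ε, e', 0) > 0` (the Gaussian case), which the definition does not presuppose either (total functions).

## The print (verbatim)

p. 605 [PDF 3]: «Z^ε = ∫dA∫dφ exp(−S^ε(A,φ)) (1.10) instead of (1.9), where the action S^ε is now defined by the
formula S(A,φ) = ½⟨φ,(−Δ^ε_A)φ⟩ + Σ_{x∈T_ε} ε^d(½m₀²|φ(x)|² + λ|φ(x)|⁴) + ½⟨A,(−Δ^ε + μ₀²)A⟩ + E. (1.11) Here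
−Δ^ε_A = D^{ε*}_A D^ε_A is the covariant Laplace operator and −Δ^ε = ∂^{ε*}∂^ε is the Laplace operator on the torus
T_ε. We will assume that μ₀² > 0 and λ > 0, and these assumptions are basic for this paper. The coefficient m₀² is more
complicated. There are (linearly) divergent self-energy diagrams for scalar field in the theory, so a
mass-renormalization counterterm is needed. As usual, we will take m₀² = m² + δm², where m² > 0 and δm² is the
counterterm given by a perturbation expansion in e and λ. This expansion, as all the other expansions in the paper,
will be taken up to some order n̄, and n̄ ≥ 6 is necessary for renormalization of the theory. It can be written down
explicitly but we will not do it because we will not use it in this paper. Let us only notice that δm² is a function of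
ε, e, λ, m², μ₀², q. Without any further assumptions on q, δm² is a N × N-matrix depending on q². For simplicity of
notations we will treat it as a number. […] The constant E in (1.12) ⟦sic: (1.11)⟧ is a sum E = E₀ + E₁, and E₀ is a
normalization constant obtained from» p. 606 [PDF 4]: «(1.10) by taking there e = λ = 0, E = 0 and m₀² = m²;
therefore we have ∫dA exp(−½⟨A,(−Δ^ε + μ₀²)A⟩)∫dφ exp(−½⟨φ,(−Δ^ε_0 + m²)φ⟩) = exp(E_{0,v})exp(E_{0,s}) = exp(E₀).
(1.12) The constant E₁ is given again by a perturbation expansion which can be written as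
E₁ = Σ_{1≤α+β≤n̄} (1/(α!β!)) e^αλ^β (∂^{α+β}/(∂e^α∂λ^β) log∫dA∫dφ exp(−S^ε(A,φ) + E))|_{e=λ=0}. (1.13)
Now the fundamental result of this paper can be formulated.
**Theorem.** For the dimensions d = 2, 3 there exist the constants E₋, E₊ independent of ε, T_ε and such that
exp(−E₋|T_ε|) ≤ Z^ε ≤ exp(E₊|T_ε|). (1.14)»
p. 607 [PDF 5]: «|Λ| = Σ_{x∈Λ} η^d = η^d (a number of points in Λ). (1.21)»
-/

namespace Literature.MathematicalPhysics.QuantumFieldTheory.Balaban1983to89.B1Sect1Statements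

open HiggsLattice

/-- `|T_ε| = Σ_{x∈T_ε} ε^d` (1.21) — the volume of the whole torus `T_ε = T^{(0)}` (`HiggsLattice.Params.vol` at
`k = 0`, `Λ = T^{(0)}`). [cite: Balaban1982Higgs1, (1.21) p.607] -/
noncomputable def volT (P : Params) : ℝ :=
  P.vol 0 Finset.univ

/-- The data held FIXED in [B1] while `ε` and the torus `T_ε` vary (*"constants E₋, E₊ independent of ε, T_ε"*,
p. 606): the dimension `d`, the number `N` of scalar components, the charge data `(e, q)` of `U(A) = exp(qεeA)` (p. 605),
the couplings `λ`, `m²`, `μ₀²` of (1.11), the order `n̄` of all perturbation expansions (p. 605), the integers `L, M` of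
the tori (1.2) (*"L, M will be described later"*, p. 604), and the mass counterterm `δm²` as a function of `(ε, e', λ')`
— DATA here because the print does not write it down (*"It can be written down explicitly but we will not do it …
δm² is a function of ε, e, λ, m², μ₀², q"*, p. 605). [cite: Balaban1982Higgs1, (1.11) p.605] -/
structure ModelData where
  d : ℕ
  N : ℕ
  C : ChargeData N
  lam : ℝ
  msq : ℝ
  mu0sq : ℝ
  nbar : ℕ
  L : ℕ
  M : ℕ
  δmsq : ℝ → ℝ → ℝ → ℝ

namespace ModelData

variable (D : ModelData)

/-- The lattices of the model: the tori `T_ε` of (1.2) with the model's `d, L, M` (spacing `ε`, `K`, `L'_μ` free).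
[cite: Balaban1982Higgs1, (1.2) p.604] -/
def Admissible (P : Params) : Prop :=
  P.d = D.d ∧ P.L = D.L ∧ P.M = D.M

/-- `Z(e', λ'; E)`: the partition function (1.10) of the action (1.11) on `T_ε = T^{(0)}` with charge `e'`, quartic
coupling `λ'`, bare mass `m₀² = m² + δm²(ε, e', λ')`, vector mass `μ₀²` and vacuum constant `E` — the function of
`(e, λ)` differentiated in (1.13) (`HiggsLattice.partitionFn`). [cite: Balaban1982Higgs1, (1.10)–(1.11) p.605] -/
noncomputable def zOf (P : Params) (e' lam' E : ℝ) : ℝ :=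
  partitionFn P 0 D.N { D.C with e := e' } ⟨D.msq + D.δmsq P.ε e' lam', lam', D.mu0sq, E⟩

/-- **(1.12)** `E₀`: *"a normalization constant obtained from (1.10) by taking there e = λ = 0, E = 0 and m₀² = m²"*,
`exp(E₀) = ∫dA exp(−½⟨A,(−Δ^ε+μ₀²)A⟩)∫dφ exp(−½⟨φ,(−Δ^ε_0+m²)φ⟩)` — `HiggsLattice.freeNormalization` at the model's
data (decl of record for (1.12): `HiggsLattice.freeNormalization`). [cite: Balaban1982Higgs1, (1.12) p.606] -/
noncomputable def e0 (P : Params) : ℝ :=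
  freeNormalization P 0 D.N D.C D.msq D.mu0sq

/-- The function `(e', λ') ↦ log ∫dA∫dφ exp(−S^ε(A,φ) + E)` of (1.13): the `+E` cancels the constant `E` of (1.11),
i.e. this is `log Z(e', λ'; 0)`. [cite: Balaban1982Higgs1, (1.13) p.606] -/
noncomputable def logZ (P : Params) (e' lam' : ℝ) : ℝ :=
  Real.log (D.zOf P e' lam' 0)

/-- **(1.13)** (p. 606 [PDF 4], verbatim): *"E₁ = Σ_{1≤α+β≤n̄} (1/(α!β!)) e^αλ^β (∂^{α+β}/(∂e^α∂λ^β) log∫dA∫dφ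
exp(−S^ε(A,φ) + E))|_{e=λ=0}"* — the Taylor polynomial of order `n̄` (without constant term) of `logZ` at
`(e', λ') = (0, 0)`, evaluated at the model's `(e, λ)`; mixed partials as iterated one-variable derivatives
(`iteratedDeriv`).  **v1.1 LOCATED DEFECT — NOT the decl of record any more**: with the TWO-SIDED `λ'`-derivative every
`β ≥ 1` term vanishes for `N ≥ 1` (`λ' ↦ logZ P e' λ'` is `0` on `λ' < 0` under Lean's total conventions; typer g24
`B1Eq113OneSidedDerivatives.iteratedDeriv_logZ_lam_eq_zero`, `e1_eq_sum_beta_zero`), so this sum keeps only the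
pure-`e` counterterms; the repaired reading (right `λ'`-derivatives at `0⁺`) is `e1R` below.  Kept verbatim for its
importers. [cite: Balaban1982Higgs1, (1.13) p.606] -/
noncomputable def e1 (P : Params) : ℝ :=
  ∑ α ∈ Finset.range (D.nbar + 1), ∑ β ∈ Finset.range (D.nbar + 1),
    if 1 ≤ α + β ∧ α + β ≤ D.nbar then
      1 / ((Nat.factorial α : ℝ) * (Nat.factorial β : ℝ)) * D.C.e ^ α * D.lam ^ β *
        iteratedDeriv α (fun e' => iteratedDeriv β (fun lam' => D.logZ P e' lam') 0) 0
    else 0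

/-- The renormalized partition function `Z^ε` of the Theorem: (1.10) with the action (1.11) at the model's `(e, λ)`,
`m₀² = m² + δm²`, and `E = E₀ + E₁` (p. 605: *"The constant E … is a sum E = E₀ + E₁"*).  v1.1: built on the
defective `e1` (see there) — the repaired decl is `zRenR` (`= zRenWith P (e1R P)`); this one `= zRenWith P (e1 P)`.
[cite: Balaban1982Higgs1, (1.10)–(1.13) pp.605–606] -/
noncomputable def zRen (P : Params) : ℝ :=
  D.zOf P D.C.e D.lam (D.e0 P + D.e1 P)

/-- The CONCRETE cutoff family of the model: one instance = one admissible lattice `P` (spacing `ε`, torus `T_ε`),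
with `eps` ↤ `ε`, `vol` ↤ `|T_ε|` (1.21), `Z` ↤ the renormalized partition function `Z^ε` (1.10)–(1.13) (`zRen`) — the
instance of r14's abstract carrier `B1LowerBound.CutoffFamily` at which the Theorem is printed.  v1.1: `Z` here is
`zRen` (defective `E₁`, see `e1`); the repaired family is `cutoffFamilyR`, the generic one `cutoffFamilyWith`.
[cite: Balaban1982Higgs1, (1.10)–(1.14) pp.605–606] -/
noncomputable def cutoffFamily : B1LowerBound.CutoffFamily {P : Params // D.Admissible P} where
  eps P := P.1.ε
  vol P := volT P.1
  Z P := D.zRen P.1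

/-! ### v1.1 — the counterterm-generic family and the repaired (one-sided) reading of (1.13) -/

/-- `Z^ε` WITH AN ARBITRARY VACUUM COUNTERTERM `E₁`: (1.10) with the action (1.11) at the model's `(e, λ)`,
`m₀² = m² + δm²`, `E = E₀ + E₁` — the common shape of `zRen` (`E₁ = e1 P`) and `zRenR` (`E₁ = e1R P`).
[cite: Balaban1982Higgs1, (1.10)–(1.12) pp.605–606] -/
noncomputable def zRenWith (P : Params) (E₁ : ℝ) : ℝ :=
  D.zOf P D.C.e D.lam (D.e0 P + E₁)

/-- the concrete cutoff family WITH AN ARBITRARY VACUUM COUNTERTERM `E₁ : Params → ℝ` (one instance = one admissible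
lattice; `eps` ↤ `ε`, `vol` ↤ `|T_ε|`, `Z` ↤ `zRenWith P (E₁ P)`). [cite: Balaban1982Higgs1, (1.10)–(1.14) pp.605–606] -/
noncomputable def cutoffFamilyWith (E₁ : Params → ℝ) : B1LowerBound.CutoffFamily {P : Params // D.Admissible P} where
  eps P := P.1.ε
  vol P := volT P.1
  Z P := D.zRenWith P.1 (E₁ P.1)

/-- **(1.13), REPAIRED READING (v1.1 decl of record)** (p. 606 [PDF 4], verbatim): *"The constant E₁ is given again
by a perturbation expansion which can be written as E₁ = Σ_{1≤α+β≤n̄} (1/(α!β!)) e^αλ^β (∂^{α+β}/(∂e^α∂λ^β)) log∫dA∫dφ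
exp(−S^ε(A,φ) + E))|_{e=λ=0}"* — the Taylor polynomial of order `n̄` (without constant term) of `logZ` at
`(e', λ') = (0, 0)`, evaluated at the model's `(e, λ)`, the `λ'`-DERIVATIVES TAKEN FROM THE RIGHT AT `0⁺`
(`iteratedDerivWithin β · (Set.Ici 0) 0`: the partition function (1.10) exists only for `λ' ≥ 0` — *"we will assume
that μ₀² > 0 and λ > 0"*, p. 605 — and the *"perturbation expansion"* is its Taylor series there), the
`e'`-derivatives two-sided (`iteratedDeriv α · 0`), inner variable `λ'`, outer `e'`.
[cite: Balaban1982Higgs1, (1.13) p.606] -/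
noncomputable def e1R (P : Params) : ℝ :=
  ∑ α ∈ Finset.range (D.nbar + 1), ∑ β ∈ Finset.range (D.nbar + 1),
    if 1 ≤ α + β ∧ α + β ≤ D.nbar then
      1 / ((Nat.factorial α : ℝ) * (Nat.factorial β : ℝ)) * D.C.e ^ α * D.lam ^ β *
        iteratedDeriv α (fun e' => iteratedDerivWithin β (fun lam' => D.logZ P e' lam') (Set.Ici 0) 0) 0
    else 0

/-- **the renormalized partition function `Z^ε` of the Theorem, REPAIRED READING (v1.1 decl of record)**: (1.10) with
the action (1.11) at the model's `(e, λ)`, `m₀² = m² + δm²`, `E = E₀ + E₁` with `E₁ = e1R` (one-sided (1.13)).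
[cite: Balaban1982Higgs1, (1.10)–(1.13) pp.605–606] -/
noncomputable def zRenR (P : Params) : ℝ :=
  D.zRenWith P (D.e1R P)

/-- **the CONCRETE cutoff family of the model, REPAIRED READING (v1.1 decl of record)**: `Z` ↤ `zRenR`.
[cite: Balaban1982Higgs1, (1.10)–(1.14) pp.605–606] -/
noncomputable def cutoffFamilyR : B1LowerBound.CutoffFamily {P : Params // D.Admissible P} :=
  D.cutoffFamilyWith D.e1R

/-- dictionary: the v1.0 `zRen` is the generic `zRenWith` at the (defective) `e1`. [cite: Balaban1982Higgs1, (1.10)–(1.13) pp.605–606, dictionary] -/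
theorem zRen_eq_zRenWith (P : Params) : D.zRen P = D.zRenWith P (D.e1 P) := rfl

/-- dictionary: `zRenR` is the generic `zRenWith` at `e1R`. [cite: Balaban1982Higgs1, (1.10)–(1.13) pp.605–606, dictionary] -/
theorem zRenR_eq_zRenWith (P : Params) : D.zRenR P = D.zRenWith P (D.e1R P) := rfl

/-- dictionary: the v1.0 family is the generic family at `e1`. [cite: Balaban1982Higgs1, (1.10)–(1.14) pp.605–606, dictionary] -/
theorem cutoffFamily_eq_cutoffFamilyWith : D.cutoffFamily = D.cutoffFamilyWith D.e1 := rfl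

/-- dictionary: the repaired family is the generic family at `e1R`. [cite: Balaban1982Higgs1, (1.10)–(1.14) pp.605–606, dictionary] -/
theorem cutoffFamilyR_eq_cutoffFamilyWith : D.cutoffFamilyR = D.cutoffFamilyWith D.e1R := rfl

/-- the `β = 0` terms (pure-`e` counterterms) of `e1` and `e1R` agree term by term (`iteratedDerivWithin 0 = id =
iteratedDeriv 0`); the two decls differ exactly in the `β ≥ 1` (`λ`-counterterm) terms.
[cite: Balaban1982Higgs1, (1.13) p.606, dictionary] -/
theorem e1R_term_beta_zero (P : Params) (α : ℕ) :
    iteratedDeriv α (fun e' => iteratedDerivWithin 0 (fun lam' => D.logZ P e' lam') (Set.Ici 0) 0) 0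
      = iteratedDeriv α (fun e' => iteratedDeriv 0 (fun lam' => D.logZ P e' lam') 0) 0 := by
  simp only [iteratedDerivWithin_zero, iteratedDeriv_zero]

end ModelData

/-- **Theorem** (p. 606 [PDF 4], verbatim): *"For the dimensions d = 2, 3 there exist the constants E₋, E₊ independent
of ε, T_ε and such that exp(−E₋|T_ε|) ≤ Z^ε ≤ exp(E₊|T_ε|). (1.14)"* — the statement of record
`B1LowerBound.ThmPrinted` INSTANTIATED at the concrete cutoff family of the lattice model, under the standing
assumptions of Sect. 1 (`d = 2, 3`; *"μ₀² > 0 and λ > 0"*, *"m² > 0"*, *"n̄ ≥ 6"*, p. 605).  Carrier note (F6): `Z^ε`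
= `ModelData.zRen` (the counterterm `δm²` is the data field `ModelData.δmsq`; the printed Theorem is this statement at
the paper's `δm²`).  Part I proves the LOWER bound (Sect. 3, via Props. 2.1–2.3, 3.1, 3.2), part II
[Balaban1982Higgs2] the upper bound.  v1.1: this is the instance at the v1.0 family `cutoffFamily` (defective `E₁`,
see `ModelData.e1`) = `Thm114With D D.e1`; the repaired instance is `Thm114R` = `Thm114With D D.e1R`.
[cite: Balaban1982Higgs1, Theorem (1.14) p.606] -/
def Thm114 (D : ModelData) : Prop :=
  (D.d = 2 ∨ D.d = 3) → 0 < D.lam → 0 < D.msq → 0 < D.mu0sq → 6 ≤ D.nbar → B1LowerBound.ThmPrinted D.cutoffFamily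

/-- The lower bound of (1.14) alone at the concrete family — the part proved in [B1] (p. 612: *"we will first prove
the lower bound in the inequality (1.14)"*; conclusion (3.68)–(3.69) p. 625); `B1LowerBound.LowerBoundPrinted`
instantiated.  v1.1: `= LowerBound114With D D.e1`; repaired instance `LowerBound114R`.
[cite: Balaban1982Higgs1, (1.14) p.606, (3.68)–(3.69) p.625] -/
def LowerBound114 (D : ModelData) : Prop :=
  (D.d = 2 ∨ D.d = 3) → 0 < D.lam → 0 < D.msq → 0 < D.mu0sq → 6 ≤ D.nbar →
    B1LowerBound.LowerBoundPrinted D.cutoffFamily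

/-- DICTIONARY (kernel-checked unfolding): at the concrete family, r14's `ThmPrinted` reads verbatim as (1.14) —
constants `E₋, E₊` chosen before the lattice, the two-sided bound on every admissible lattice.
[cite: Balaban1982Higgs1, Theorem (1.14) p.606] -/
theorem thmPrinted_cutoffFamily_iff (D : ModelData) :
    B1LowerBound.ThmPrinted D.cutoffFamily ↔
      ∃ Em Ep : ℝ, ∀ P : Params, D.Admissible P →
        Real.exp (-(Em * volT P)) ≤ D.zRen P ∧ D.zRen P ≤ Real.exp (Ep * volT P) := by
  constructor
  · rintro ⟨Em, Ep, h⟩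
    exact ⟨Em, Ep, fun P hP => h ⟨P, hP⟩⟩
  · rintro ⟨Em, Ep, h⟩
    exact ⟨Em, Ep, fun P => h P.1 P.2⟩

/-- DICTIONARY: the lower-bound half at the concrete family, unfolded. [cite: Balaban1982Higgs1, Theorem (1.14) p.606] -/
theorem lowerBoundPrinted_cutoffFamily_iff (D : ModelData) :
    B1LowerBound.LowerBoundPrinted D.cutoffFamily ↔
      ∃ Em : ℝ, ∀ P : Params, D.Admissible P → Real.exp (-(Em * volT P)) ≤ D.zRen P := by
  constructor
  · rintro ⟨Em, h⟩
    exact ⟨Em, fun P hP => h ⟨P, hP⟩⟩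
  · rintro ⟨Em, h⟩
    exact ⟨Em, fun P => h P.1 P.2⟩

/-- The concrete Theorem unfolded: (1.14) on every admissible lattice, constants before the lattice.
[cite: Balaban1982Higgs1, Theorem (1.14) p.606] -/
theorem thm114_iff (D : ModelData) :
    Thm114 D ↔
      ((D.d = 2 ∨ D.d = 3) → 0 < D.lam → 0 < D.msq → 0 < D.mu0sq → 6 ≤ D.nbar →
        ∃ Em Ep : ℝ, ∀ P : Params, D.Admissible P →
          Real.exp (-(Em * volT P)) ≤ D.zRen P ∧ D.zRen P ≤ Real.exp (Ep * volT P)) := by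
  unfold Thm114
  rw [thmPrinted_cutoffFamily_iff]

/-- The Theorem implies its lower-bound half (B1's part), via r14's `B1LowerBound.thmPrinted_iff`.
[cite: Balaban1982Higgs1, Theorem (1.14) p.606] -/
theorem lowerBound114_of_thm114 (D : ModelData) (h : Thm114 D) : LowerBound114 D :=
  fun hd hlam hm hmu hn => ((B1LowerBound.thmPrinted_iff _).1 (h hd hlam hm hmu hn)).1

/-! ## v1.1 — the Theorem at the counterterm-generic family and at the repaired family -/

/-- **Theorem (1.14) INSTANTIATED at the concrete family WITH AN ARBITRARY VACUUM COUNTERTERM `E₁`** (standing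
assumptions of Sect. 1 as antecedents): the common shape of `Thm114` (`E₁ = e1`) and `Thm114R` (`E₁ = e1R`).
[cite: Balaban1982Higgs1, Theorem (1.14) p.606] -/
def Thm114With (D : ModelData) (E₁ : Params → ℝ) : Prop :=
  (D.d = 2 ∨ D.d = 3) → 0 < D.lam → 0 < D.msq → 0 < D.mu0sq → 6 ≤ D.nbar →
    B1LowerBound.ThmPrinted (D.cutoffFamilyWith E₁)

/-- the lower half of (1.14) at the counterterm-generic family. [cite: Balaban1982Higgs1, (1.14) p.606, (3.68)–(3.69) p.625] -/
def LowerBound114With (D : ModelData) (E₁ : Params → ℝ) : Prop :=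
  (D.d = 2 ∨ D.d = 3) → 0 < D.lam → 0 < D.msq → 0 < D.mu0sq → 6 ≤ D.nbar →
    B1LowerBound.LowerBoundPrinted (D.cutoffFamilyWith E₁)

/-- **Theorem** (p. 606 [PDF 4], verbatim): *"For the dimensions d = 2, 3 there exist the constants E₋, E₊ independent
of ε, T_ε and such that exp(−E₋|T_ε|) ≤ Z^ε ≤ exp(E₊|T_ε|). (1.14)"* — `B1LowerBound.ThmPrinted` INSTANTIATED at the
REPAIRED concrete cutoff family `cutoffFamilyR` (`Z^ε` with `E = E₀ + E₁`, `E₁ = e1R` the one-sided (1.13)), under the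
standing assumptions of Sect. 1 (`d = 2, 3`; *"μ₀² > 0 and λ > 0"*, *"m² > 0"*, *"n̄ ≥ 6"*).  **v1.1 DECL OF RECORD for
the concrete instance of row B1.Thm@606** (the printed Theorem is this statement at the paper's `δm²`).
[cite: Balaban1982Higgs1, Theorem (1.14) p.606] -/
def Thm114R (D : ModelData) : Prop :=
  Thm114With D D.e1R

/-- the lower bound of (1.14) alone at the repaired family — the part proved in [B1]. [cite: Balaban1982Higgs1, (1.14) p.606, (3.68)–(3.69) p.625] -/
def LowerBound114R (D : ModelData) : Prop :=
  LowerBound114With D D.e1R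

/-- dictionary: the v1.0 `Thm114` is `Thm114With` at `e1`. [cite: Balaban1982Higgs1, Theorem (1.14) p.606, dictionary] -/
theorem thm114_iff_thm114With (D : ModelData) : Thm114 D ↔ Thm114With D D.e1 := Iff.rfl

/-- dictionary: the v1.0 `LowerBound114` is `LowerBound114With` at `e1`. [cite: Balaban1982Higgs1, (1.14) p.606, dictionary] -/
theorem lowerBound114_iff_lowerBound114With (D : ModelData) : LowerBound114 D ↔ LowerBound114With D D.e1 := Iff.rfl

/-- DICTIONARY (kernel-checked unfolding): at the counterterm-generic family r14's `ThmPrinted` reads verbatim as (1.14)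
for `Z^ε = zRenWith P (E₁ P)` — constants before the lattice, the two-sided bound on every admissible lattice.
[cite: Balaban1982Higgs1, Theorem (1.14) p.606] -/
theorem thmPrinted_cutoffFamilyWith_iff (D : ModelData) (E₁ : Params → ℝ) :
    B1LowerBound.ThmPrinted (D.cutoffFamilyWith E₁) ↔
      ∃ Em Ep : ℝ, ∀ P : Params, D.Admissible P →
        Real.exp (-(Em * volT P)) ≤ D.zRenWith P (E₁ P) ∧ D.zRenWith P (E₁ P) ≤ Real.exp (Ep * volT P) := by
  constructor
  · rintro ⟨Em, Ep, h⟩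
    exact ⟨Em, Ep, fun P hP => h ⟨P, hP⟩⟩
  · rintro ⟨Em, Ep, h⟩
    exact ⟨Em, Ep, fun P => h P.1 P.2⟩

/-- DICTIONARY: the lower-bound half at the counterterm-generic family, unfolded. [cite: Balaban1982Higgs1, Theorem (1.14) p.606] -/
theorem lowerBoundPrinted_cutoffFamilyWith_iff (D : ModelData) (E₁ : Params → ℝ) :
    B1LowerBound.LowerBoundPrinted (D.cutoffFamilyWith E₁) ↔
      ∃ Em : ℝ, ∀ P : Params, D.Admissible P → Real.exp (-(Em * volT P)) ≤ D.zRenWith P (E₁ P) := by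
  constructor
  · rintro ⟨Em, h⟩
    exact ⟨Em, fun P hP => h ⟨P, hP⟩⟩
  · rintro ⟨Em, h⟩
    exact ⟨Em, fun P => h P.1 P.2⟩

/-- the repaired concrete Theorem unfolded: (1.14) for `Z^ε = zRenR` on every admissible lattice, constants before the
lattice. [cite: Balaban1982Higgs1, Theorem (1.14) p.606] -/
theorem thm114R_iff (D : ModelData) :
    Thm114R D ↔
      ((D.d = 2 ∨ D.d = 3) → 0 < D.lam → 0 < D.msq → 0 < D.mu0sq → 6 ≤ D.nbar →
        ∃ Em Ep : ℝ, ∀ P : Params, D.Admissible P →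
          Real.exp (-(Em * volT P)) ≤ D.zRenR P ∧ D.zRenR P ≤ Real.exp (Ep * volT P)) := by
  unfold Thm114R Thm114With
  rw [thmPrinted_cutoffFamilyWith_iff]
  rfl

/-- the Theorem at the generic family implies its lower-bound half. [cite: Balaban1982Higgs1, Theorem (1.14) p.606] -/
theorem lowerBound114With_of_thm114With (D : ModelData) (E₁ : Params → ℝ) (h : Thm114With D E₁) :
    LowerBound114With D E₁ :=
  fun hd hlam hm hmu hn => ((B1LowerBound.thmPrinted_iff _).1 (h hd hlam hm hmu hn)).1

/-- the repaired Theorem implies its lower-bound half (B1's part). [cite: Balaban1982Higgs1, Theorem (1.14) p.606] -/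
theorem lowerBound114R_of_thm114R (D : ModelData) (h : Thm114R D) : LowerBound114R D :=
  lowerBound114With_of_thm114With D D.e1R h

end Literature.MathematicalPhysics.QuantumFieldTheory.Balaban1983to89.B1Sect1Statements
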